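import Mathlib

/-!
# The norm spaces of the first residual classes after D8 are anisotropic: `{v₋, 𝔭₁₁}` of `ℚ(ζ₁₂)` at `3`, `{v₋, 𝔭₇}` of `ℚ(ζ₈)` at `2`
(P2-ResidualClassesAnisotropy v1; ROUTE v1.20 §4 (B7)(2) «hub wanted by class»; seat p2 (g2), pub-hodge-repro0)

Setting (P2-MoonenClasses-v2 v1.2 §4, AnisotropicClassZeta12.lean): for a `K`-fourfold `D` of signature `((2,0),(1,1))` with
hermitian class `c ∈ K⁺^×/N(K^×)`, the rational quadratic space of the `K`-line `det_K H¹(D)` is the norm space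
`Q_c(x) = Tr_{K⁺/ℚ}(c · x · x̄)` on `K`; a K3 surface `Y` with `T(Y)_ℚ ≅ Q_c` has a Shioda–Inose structure only if `Q_c` is
isotropic (Morrison Cor 6.4(ii): `ρ = 18` needs a `U`-summand). For `K = K⁺(i)` and `x = a + bi` (`a, b ∈ K⁺`), `x x̄ = a² + b²`,
so `Q_c = q_c ⊥ q_c` with the binary form `q_c(a) = Tr_{K⁺/ℚ}(c a²)`.
* `ℚ(ζ₁₂) = ℚ(√3)(i)`, `c = 1 + 2√3` (norm `−11`, positive at `v₊`, negative at `v₋`: the class `{v₋, 𝔭₁₁}`, the FIRST residual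
  class after D8 — p7 INBOX 21:17:42Z (2)): `q_c(a₀ + a₁√3) = 2a₀² + 6a₁² + 24a₀a₁` (`trace_form_three`), so `Q_c = 2·q11` with
  `q11(a₀,a₁,b₀,b₁) = a₀² + 3a₁² + 12a₀a₁ + b₀² + 3b₁² + 12b₀b₁`; `anisotropic_eleven`: `q11 = 0` only at `0` (3-adic descent:
  `q11 ≡ a₀² + b₀² (mod 3)`, then `≡ 3(a₁² + b₁²) (mod 9)`, and `q11(3v) = 9 q11(v)`).
* `ℚ(ζ₈) = ℚ(√2)(i)`, `c = 1 + 2√2` (norm `−7`: the class `{v₋, 𝔭₇}`, the first residual class for `ℚ(ζ₈)` — p2 INBOX 21:22:14Z):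
  `q_c(a₀ + a₁√2) = 2a₀² + 4a₁² + 16a₀a₁` (`trace_form_two`), `Q_c = 2·q7` with `q7 = a₀² + 2a₁² + 8a₀a₁ + b₀² + 2b₁² + 8b₀b₁`;
  `anisotropic_seven`: `q7 = 0` only at `0` (2-adic descent: `x² + y² + 2u² + 2v² + 8w = 0` forces `x, y` even — odd `x, y` would
  give `2 + 2(u² + v²) ≡ 0 (mod 8)`, i.e. `u² + v² ≡ 3 (mod 4)`; then the same for `(a₁, b₁)`, and `q7(2v) = 4 q7(v)`).
Hence neither class lies in `cl(T(S))·[ℚ^×]` (the twisted-Kummer / Shioda–Inose classes of `S = E × E′`): the hub geometry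
«Kummer / Shioda–Inose of products of CM elliptic curves with a twist» of ROUTE v1.20 §4 (B7)(2) cannot carry either class.
The general statement (every residual class `{v₋, 𝔭_p}`, `p ≡ 11 (mod 12)` resp. `p ≡ 7 (mod 8)`, by the Hilbert symbol
`(−1, −3N(c))₃ = −1` resp. `(−1, −2N(c))₂ = −1`) is in the note; here the two first members are certified by descent.
-/

namespace HodgeRepro0.AnisotropicResidualClasses

/-- `ℤ[√3]` as pairs `(r, s) = r + s√3`: multiplication -/
def mul3 (x y : ℤ × ℤ) : ℤ × ℤ := (x.1 * y.1 + 3 * x.2 * y.2, x.1 * y.2 + x.2 * y.1)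

/-- `ℤ[√2]` as pairs `(r, s) = r + s√2`: multiplication -/
def mul2 (x y : ℤ × ℤ) : ℤ × ℤ := (x.1 * y.1 + 2 * x.2 * y.2, x.1 * y.2 + x.2 * y.1)

/-- the trace `Tr_{K⁺/ℚ}(r + s√d) = 2r` -/
def tr (x : ℤ × ℤ) : ℤ := 2 * x.1

/-- the norm of `1 + 2√3` is `−11` -/
theorem norm_three : (1 : ℤ) * 1 - 3 * (2 * 2) = -11 := by norm_num

/-- the norm of `1 + 2√2` is `−7` -/
theorem norm_two : (1 : ℤ) * 1 - 2 * (2 * 2) = -7 := by norm_num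

/-- `Tr_{ℚ(√3)/ℚ}((1 + 2√3)(a₀ + a₁√3)²) = 2a₀² + 6a₁² + 24a₀a₁` -/
theorem trace_form_three (a0 a1 : ℤ) :
    tr (mul3 (1, 2) (mul3 (a0, a1) (a0, a1))) = 2 * a0 ^ 2 + 6 * a1 ^ 2 + 24 * a0 * a1 := by
  simp only [mul3, tr]; ring

/-- `Tr_{ℚ(√2)/ℚ}((1 + 2√2)(a₀ + a₁√2)²) = 2a₀² + 4a₁² + 16a₀a₁` -/
theorem trace_form_two (a0 a1 : ℤ) :
    tr (mul2 (1, 2) (mul2 (a0, a1) (a0, a1))) = 2 * a0 ^ 2 + 4 * a1 ^ 2 + 16 * a0 * a1 := by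
  simp only [mul2, tr]; ring

/-- `q11 = Q_{1+2√3}/2` on `ℚ(ζ₁₂)`, `x = a₀ + a₁√3 + i(b₀ + b₁√3)` -/
def q11 (a0 a1 b0 b1 : ℤ) : ℤ :=
  a0 ^ 2 + 3 * a1 ^ 2 + 12 * a0 * a1 + b0 ^ 2 + 3 * b1 ^ 2 + 12 * b0 * b1

/-- `q7 = Q_{1+2√2}/2` on `ℚ(ζ₈)`, `x = a₀ + a₁√2 + i(b₀ + b₁√2)` -/
def q7 (a0 a1 b0 b1 : ℤ) : ℤ :=
  a0 ^ 2 + 2 * a1 ^ 2 + 8 * a0 * a1 + b0 ^ 2 + 2 * b1 ^ 2 + 8 * b0 * b1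

/-- a square is `0` or `1` modulo `3` -/
lemma sq_emod_three (x : ℤ) : x ^ 2 % 3 = 0 ∨ x ^ 2 % 3 = 1 := by
  have h0 : 0 ≤ x % 3 := Int.emod_nonneg x (by norm_num)
  have h3 : x % 3 < 3 := Int.emod_lt_of_pos x (by norm_num)
  have : x ^ 2 % 3 = (x % 3) * (x % 3) % 3 := by rw [pow_two, Int.mul_emod]
  rw [this]
  interval_cases (x % 3) <;> simp

/-- if `3 ∣ b² + u²` then `3 ∣ b` and `3 ∣ u` -/
lemma three_dvd_of_sq_add_sq {b u : ℤ} (h : (3 : ℤ) ∣ b ^ 2 + u ^ 2) : 3 ∣ b ∧ 3 ∣ u := by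
  have hb := sq_emod_three b
  have hu := sq_emod_three u
  have hsum : (b ^ 2 + u ^ 2) % 3 = 0 := Int.emod_eq_zero_of_dvd h
  have hadd : (b ^ 2 + u ^ 2) % 3 = ((b ^ 2 % 3) + (u ^ 2 % 3)) % 3 := Int.add_emod _ _ _
  have hb0 : b ^ 2 % 3 = 0 := by omega
  have hu0 : u ^ 2 % 3 = 0 := by omega
  exact ⟨Int.prime_three.dvd_of_dvd_pow (Int.dvd_of_emod_eq_zero hb0),
         Int.prime_three.dvd_of_dvd_pow (Int.dvd_of_emod_eq_zero hu0)⟩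

/-- `q11(3a₀, 3a₁, 3b₀, 3b₁) = 9 q11(a₀, a₁, b₀, b₁)` -/
lemma q11_three_mul (a0 a1 b0 b1 : ℤ) :
    q11 (3 * a0) (3 * a1) (3 * b0) (3 * b1) = 9 * q11 a0 a1 b0 b1 := by
  unfold q11; ring

/-- `q11(3a, a₁, 3b, b₁) = 3(a₁² + b₁²) + 9(a² + 4aa₁ + b² + 4bb₁)` -/
lemma q11_shift (a a1 b b1 : ℤ) :
    q11 (3 * a) a1 (3 * b) b1 = 3 * (a1 ^ 2 + b1 ^ 2) + 9 * (a ^ 2 + 4 * a * a1 + b ^ 2 + 4 * b * b1) := by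
  unfold q11; ring

/-- 3-adic descent for `q11`: every integer zero with `|a₀| + |a₁| + |b₀| + |b₁| ≤ n` is the zero vector -/
lemma descent11 (n : ℕ) : ∀ a0 a1 b0 b1 : ℤ, a0.natAbs + a1.natAbs + b0.natAbs + b1.natAbs ≤ n →
    q11 a0 a1 b0 b1 = 0 → a0 = 0 ∧ a1 = 0 ∧ b0 = 0 ∧ b1 = 0 := by
  induction n with
  | zero =>
    intro a0 a1 b0 b1 hn _
    have h0 : a0.natAbs = 0 := by omega
    have h1 : a1.natAbs = 0 := by omega
    have h2 : b0.natAbs = 0 := by omega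
    have h3 : b1.natAbs = 0 := by omega
    exact ⟨Int.natAbs_eq_zero.mp h0, Int.natAbs_eq_zero.mp h1, Int.natAbs_eq_zero.mp h2, Int.natAbs_eq_zero.mp h3⟩
  | succ n ih =>
    intro a0 a1 b0 b1 hn h
    -- step 1: `q11 ≡ a₀² + b₀² (mod 3)`
    have h1 : (3 : ℤ) ∣ a0 ^ 2 + b0 ^ 2 := by
      refine ⟨-(a1 ^ 2 + 4 * a0 * a1 + b1 ^ 2 + 4 * b0 * b1), ?_⟩
      unfold q11 at h; linarith
    obtain ⟨⟨a, rfl⟩, ⟨b, rfl⟩⟩ := three_dvd_of_sq_add_sq h1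
    -- step 2: `q11(3a, a₁, 3b, b₁) = 3(a₁² + b₁²) + 9(…)`
    have h2 : (3 : ℤ) ∣ a1 ^ 2 + b1 ^ 2 := by
      refine ⟨-(a ^ 2 + 4 * a * a1 + b ^ 2 + 4 * b * b1), ?_⟩
      have := q11_shift a a1 b b1
      linarith
    obtain ⟨⟨a', rfl⟩, ⟨b', rfl⟩⟩ := three_dvd_of_sq_add_sq h2
    rw [q11_three_mul] at h
    have h' : q11 a a' b b' = 0 := by omega
    have hsize : a.natAbs + a'.natAbs + b.natAbs + b'.natAbs ≤ n := by
      rw [Int.natAbs_mul, Int.natAbs_mul, Int.natAbs_mul, Int.natAbs_mul] at hn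
      simp only [Int.reduceAbs] at hn
      omega
    obtain ⟨ha, ha', hb, hb'⟩ := ih a a' b b' hsize h'
    subst ha ha' hb hb'
    exact ⟨by ring, by ring, by ring, by ring⟩

/-- the norm space of the class `{v₋, 𝔭₁₁}` of `ℚ(ζ₁₂)` (representative `1 + 2√3`) is anisotropic -/
theorem anisotropic_eleven (a0 a1 b0 b1 : ℤ) (h : q11 a0 a1 b0 b1 = 0) :
    a0 = 0 ∧ a1 = 0 ∧ b0 = 0 ∧ b1 = 0 :=
  descent11 _ a0 a1 b0 b1 le_rfl h

/-- a square modulo `8` is `0`, `1` or `4`, and it is `1` exactly for odd arguments -/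
lemma sq_emod_eight (x : ℤ) :
    (x % 2 = 0 ∧ (x ^ 2 % 8 = 0 ∨ x ^ 2 % 8 = 4)) ∨ (x % 2 = 1 ∧ x ^ 2 % 8 = 1) := by
  have h0 : 0 ≤ x % 8 := Int.emod_nonneg x (by norm_num)
  have h8 : x % 8 < 8 := Int.emod_lt_of_pos x (by norm_num)
  have hsq : x ^ 2 % 8 = (x % 8) * (x % 8) % 8 := by rw [pow_two, Int.mul_emod]
  have hpar : x % 2 = (x % 8) % 2 := by omega
  rw [hsq, hpar]
  interval_cases (x % 8) <;> simp

/-- a square is `0` or `1` modulo `4` -/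
lemma sq_emod_four (x : ℤ) : x ^ 2 % 4 = 0 ∨ x ^ 2 % 4 = 1 := by
  have h0 : 0 ≤ x % 4 := Int.emod_nonneg x (by norm_num)
  have h4 : x % 4 < 4 := Int.emod_lt_of_pos x (by norm_num)
  have : x ^ 2 % 4 = (x % 4) * (x % 4) % 4 := by rw [pow_two, Int.mul_emod]
  rw [this]
  interval_cases (x % 4) <;> simp

/-- `x² + y² + 2u² + 2v² + 8w = 0` forces `x` and `y` even -/
lemma even_even_of_eq {x y u v w : ℤ} (h : x ^ 2 + y ^ 2 + 2 * u ^ 2 + 2 * v ^ 2 + 8 * w = 0) :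
    2 ∣ x ∧ 2 ∣ y := by
  have hx := sq_emod_eight x
  have hy := sq_emod_eight y
  have hu := sq_emod_four u
  have hv := sq_emod_four v
  have hx2 : x % 2 = 0 := by omega
  have hy2 : y % 2 = 0 := by omega
  exact ⟨Int.dvd_of_emod_eq_zero hx2, Int.dvd_of_emod_eq_zero hy2⟩

/-- `q7(2a₀, 2a₁, 2b₀, 2b₁) = 4 q7(a₀, a₁, b₀, b₁)` -/
lemma q7_two_mul (a0 a1 b0 b1 : ℤ) :
    q7 (2 * a0) (2 * a1) (2 * b0) (2 * b1) = 4 * q7 a0 a1 b0 b1 := by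
  unfold q7; ring

/-- 2-adic descent for `q7` -/
lemma descent7 (n : ℕ) : ∀ a0 a1 b0 b1 : ℤ, a0.natAbs + a1.natAbs + b0.natAbs + b1.natAbs ≤ n →
    q7 a0 a1 b0 b1 = 0 → a0 = 0 ∧ a1 = 0 ∧ b0 = 0 ∧ b1 = 0 := by
  induction n with
  | zero =>
    intro a0 a1 b0 b1 hn _
    have h0 : a0.natAbs = 0 := by omega
    have h1 : a1.natAbs = 0 := by omega
    have h2 : b0.natAbs = 0 := by omega
    have h3 : b1.natAbs = 0 := by omega
    exact ⟨Int.natAbs_eq_zero.mp h0, Int.natAbs_eq_zero.mp h1, Int.natAbs_eq_zero.mp h2, Int.natAbs_eq_zero.mp h3⟩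
  | succ n ih =>
    intro a0 a1 b0 b1 hn h
    -- step 1: `a₀, b₀` even
    have h1 : a0 ^ 2 + b0 ^ 2 + 2 * a1 ^ 2 + 2 * b1 ^ 2 + 8 * (a0 * a1 + b0 * b1) = 0 := by
      unfold q7 at h; linarith
    obtain ⟨⟨a, rfl⟩, ⟨b, rfl⟩⟩ := even_even_of_eq h1
    -- step 2: `q7(2a, a₁, 2b, b₁) = 2(a₁² + b₁² + 2a² + 2b² + 8(a a₁ + b b₁))`, so `a₁, b₁` even
    have h2 : a1 ^ 2 + b1 ^ 2 + 2 * a ^ 2 + 2 * b ^ 2 + 8 * (a * a1 + b * b1) = 0 := by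
      unfold q7 at h; linarith
    obtain ⟨⟨a', rfl⟩, ⟨b', rfl⟩⟩ := even_even_of_eq h2
    rw [q7_two_mul] at h
    have h' : q7 a a' b b' = 0 := by omega
    have hsize : a.natAbs + a'.natAbs + b.natAbs + b'.natAbs ≤ n := by
      rw [Int.natAbs_mul, Int.natAbs_mul, Int.natAbs_mul, Int.natAbs_mul] at hn
      simp only [Int.reduceAbs] at hn
      omega
    obtain ⟨ha, ha', hb, hb'⟩ := ih a a' b b' hsize h'
    subst ha ha' hb hb'
    exact ⟨by ring, by ring, by ring, by ring⟩

/-- the norm space of the class `{v₋, 𝔭₇}` of `ℚ(ζ₈)` (representative `1 + 2√2`) is anisotropic -/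
theorem anisotropic_seven (a0 a1 b0 b1 : ℤ) (h : q7 a0 a1 b0 b1 = 0) :
    a0 = 0 ∧ a1 = 0 ∧ b0 = 0 ∧ b1 = 0 :=
  descent7 _ a0 a1 b0 b1 le_rfl h

/-- control: the norm space of `cl(2√3)` (row (20), which HAS a Shioda–Inose structure) is isotropic:
`Tr_{ℚ(√3)/ℚ}(2√3 · 1²) = 0` -/
theorem isotropic_control : tr (mul3 (0, 2) (mul3 (1, 0) (1, 0))) = 0 := by
  simp only [mul3, tr]; norm_num

/-- control: the norm space of `cl(√2)` (row (15)) is isotropic: `Tr_{ℚ(√2)/ℚ}(√2 · 1²) = 0` -/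
theorem isotropic_control_two : tr (mul2 (0, 1) (mul2 (1, 0) (1, 0))) = 0 := by
  simp only [mul2, tr]; norm_num

end HodgeRepro0.AnisotropicResidualClasses
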